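import Literature.RepresentationTheory.FiniteGroups.SymmetricGroupFrobeniusOrthogonality
import Literature.RepresentationTheory.FiniteGroups.WordIsotypicDominance
import Literature.NumberTheory.DiophantineGeometry.WordIsotypicSupport
import HarnessLib

/-!
# Frobenius's character formula for the symmetric groups

Topic `Literature/RepresentationTheory/FiniteGroups`. For a partition `λ ⊢ D` with at most `N`
parts and `σ ∈ 𝔖_D`, the character of the Specht module `S^λ = ℂ[𝔖_D] c_λ` (the tree's
`spechtCharacter ℂ λ`, `SymmetricGroupReps.lean`) is given by **Frobenius's formula**
(Frobenius 1900; Fulton–Harris, *Representation Theory*, Thm. 4.10 and §4.3; Macdonald,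
*Symmetric Functions and Hall Polynomials*, Ch. I (7.8); James–Kerber 2.3.15):

  `χ^λ(σ) = [x^{λ+ρ}] ( ∏_{i<j} (x_i - x_j) · ∏_{cycles c of σ} (x_1^{|c|} + ⋯ + x_N^{|c|}) )`,

`ρ = (N - 1, …, 1, 0)`. PROVED here as `spechtCharacter_eq_frobeniusChar`
(`χ^λ(σ) = frobeniusChar N λ σ`, the right-hand side being the integer defined in
`SymmetricGroupFixedWords.lean` through the fixed-word enumerator `F_σ = ∏ p_{|c|}`), together with
the expanded, permutation-module form `spechtCharacter_eq_sum_sign_mul_card`: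
`χ^λ(σ) = ∑_{τ ∈ 𝔖_N} sign(τ) · #{w : [D] → [N] | w ∘ σ = w, cont(w) = λ + ρ - ρ∘τ⁻¹}`
(Fulton–Harris (4.41): `χ_λ = ∑_τ sign(τ) ψ_{λ+ρ-τρ}`, `ψ_μ = Ind_{𝔖_μ}^{𝔖_D} 1`). The
Murnaghan–Nakayama rule, the hook-length/degree formula and all character values of `𝔖_D` are
formal consequences of this statement (first consumer:
`Literature/Computability/Complexity/OccurrenceObstructionsIPSquareValues.lean`).

## The proof (Frobenius–Schur, arranged to need neither Young's rule nor completeness)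

Write `X = X^λ = frobeniusChar N λ` and `χ = χ^λ`, both real-valued functions on `𝔖_D`.
1. `∑_σ X(σ)² = D!` — `sum_frobeniusChar_mul_self` (`SymmetricGroupFrobeniusOrthogonality.lean`:
   Burnside's count + Cauchy's identity for bialternants).
2. `∑_σ X(σ) χ(σ) = D!` — `sum_frobeniusChar_mul_spechtCharacter` (this file). Expanding
   `X = ∑_τ sign(τ) ψ_τ` with `ψ_τ(σ) = #{w ∈ W_τ | w∘σ = w}` and exchanging sums,
   `∑_σ ψ_τ(σ)χ(σ) = ∑_{w ∈ W_τ} ∑_{σ ∈ Stab w} χ(σ)`. For `τ ≠ 1` every `w ∈ W_τ` VIOLATES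
   DOMINANCE (`exists_partialSum_lt_of_ne_one`: with `i₀` the least moved point of `τ⁻¹`, the
   first `i₀ + 1` letters occupy more than `λ₁ + ⋯ + λ_{i₀+1}` positions), so the inner sum
   vanishes by the tree's majorisation property of the isotypic projector
   (`card_filter_lt_le_of_wordIsotypicMatrix_diag_ne_zero`, `WordIsotypicDominance.lean`;
   Fulton–Harris Lemma 4.23). For `τ = 1`, `W_1` is the set of words of content `λ`, one orbit of
   the row word `p ↦ rowOf p`, whose stabiliser is the row group `R_λ` with
   `dim (S^λ)^{R_λ} = 1` (`finrank_invariants_rowWord`, i.e. `K_{λλ} = 1`, from the tree's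
   `exists_rowSymmetrizer_mul_mul_colAntisymmetrizer` = Fulton–Harris Lemma 4.23 (2)); by
   orbit–stabilizer the `τ = 1` term is `D!` (`sum_sum_stab_spechtCharacter_rowWord`).
3. `∑_σ χ(σ)² = D!` — orthonormality of the irreducible character `χ^λ` (Mathlib
   `Representation.char_orthonormal`, the tree's `isIrreducible_spechtRep_holds`,
   `spechtCharacter_inv`).
Hence `∑_σ (X(σ) - χ(σ))² = 0` with real terms (`star_spechtCharacter`), so `X = χ`.

## References

* G. Frobenius, *Über die Charaktere der symmetrischen Gruppe*, S'ber. Akad. Wiss. Berlin (1900)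
  516–534 (the formula). Cited through:
* W. Fulton, J. Harris, *Representation Theory. A First Course*, GTM 129 (1991), Thm. 4.10,
  §4.3 (Prop. 4.37, Cor. 4.39, (4.41)), Lemma 4.23. [FultonHarrisGTM129]
* I. G. Macdonald, *Symmetric Functions and Hall Polynomials*, 2nd ed. (1995), Ch. I §7.
  [Macdonald1995]
* G. James, A. Kerber, *The Representation Theory of the Symmetric Group* (1981), 2.3.15.
  [JamesKerber1981]

## Mathlib and tree

Mathlib: `Representation.char_orthonormal`, `Representation.char_one`, `Representation.invariants`,
`finrank_span_singleton`, `Finset.min'`, `Complex.conj_eq_iff_re`. Tree: `frobeniusChar`,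
`frobeniusChar_eq_sum_sign_mul_card`, `wordExps` (`SymmetricGroupFixedWords.lean`);
`sum_frobeniusChar_mul_self`, `sum_comp_perm_eq_card_stab_smul`
(`SymmetricGroupFrobeniusOrthogonality.lean`); `wordStabilizer`, `stabFinset`, `stabSymmetrizer`,
`spechtRepStab`, `wordIsotypicMatrix_diag_eq`, `sum_spechtCharacter_wordStabilizer`,
`card_filter_lt_le_of_wordIsotypicMatrix_diag_ne_zero` (`WordIsotypicDominance.lean`);
`card_filter_rowOf_lt` (`WordIsotypicSupport.lean`); `rowStabilizer`, `rowSymmetrizer`,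
`youngSymmetrizer`, `spechtRep_apply`, `exists_rowSymmetrizer_mul_mul_colAntisymmetrizer`,
`isIrreducible_spechtRep_holds`, `finrank_spechtIdeal_holds`, `youngSymmetrizer_ne_zero_holds`,
`star_spechtCharacter`, `spechtCharacter_inv`. Mathlib has no character values of `𝔖_n` beyond
`χ(1)` (checked: `lean search 'Frobenius.*formula|Murnaghan|hook.?length formula'`).
-/

noncomputable section

open scoped BigOperators
open Finset

namespace Literature.RepresentationTheory.FiniteGroups

open Module
open Literature.RingTheory.SymmetricFunctions.SymmPoly (rho rho_apply)
open Literature.NumberTheory.DiophantineGeometry (Word wordContent spechtRep spechtIdeal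
  spechtCharacter spechtRep_apply spechtCharacter_conj youngSymmetrizer rowSymmetrizer
  colAntisymmetrizer rowStabilizer mem_rowStabilizer_iff
  exists_rowSymmetrizer_mul_mul_colAntisymmetrizer isIrreducible_spechtRep_holds
  finrank_spechtIdeal_holds numStandardTableaux_pos_holds youngSymmetrizer_ne_zero_holds
  card_filter_rowOf_lt)

section Counting

variable {N D : ℕ}

/-- The stabiliser finset of the dominance file is `{σ | w ∘ σ = w}`. [folklore] -/
theorem filter_comp_eq_stabFinset (w : Word N D) :
    (univ.filter fun σ : Equiv.Perm (Fin D) => w ∘ ⇑σ = w) = stabFinset w := by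
  ext σ
  rw [mem_stabFinset, mem_wordStabilizer_iff_comp]
  simp

/-- Exchange of summations against a function of `σ`:
`∑_σ #{w ∈ W | w ∘ σ = w} · g(σ) = ∑_{w ∈ W} ∑_{σ ∈ Stab w} g(σ)`. [folklore] -/
theorem sum_card_filter_mul_eq_sum_sum_stab (W : Finset (Word N D)) (g : Equiv.Perm (Fin D) → ℂ) :
    ∑ σ : Equiv.Perm (Fin D), ((W.filter fun w => w ∘ ⇑σ = w).card : ℂ) * g σ =
      ∑ w ∈ W, ∑ σ ∈ stabFinset w, g σ := by
  have h1 : ∀ σ : Equiv.Perm (Fin D), ((W.filter fun w => w ∘ ⇑σ = w).card : ℂ) * g σ =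
      ∑ w ∈ W, if w ∘ ⇑σ = w then g σ else 0 := by
    intro σ
    rw [Finset.card_filter, Nat.cast_sum, Finset.sum_mul]
    refine Finset.sum_congr rfl fun w _ => ?_
    split_ifs <;> simp
  simp_rw [h1]
  rw [Finset.sum_comm]
  refine Finset.sum_congr rfl fun w _ => ?_
  rw [← Finset.sum_filter, filter_comp_eq_stabFinset]

/-- The number of positions with letter `< a` is the partial sum of the content:
`#{p | w p < a} = ∑_{j < a} cont(w)_j`. [folklore] -/
theorem card_filter_lt_eq_sum_wordContent (w : Word N D) (a : ℕ) :
    (univ.filter fun p : Fin D => (w p : ℕ) < a).card =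
      ∑ j ∈ univ.filter (fun j : Fin N => (j : ℕ) < a), wordContent w j := by
  rw [Finset.card_eq_sum_card_fiberwise (f := w) (t := univ.filter fun j : Fin N => (j : ℕ) < a)
    (fun p hp => by simpa using hp)]
  refine Finset.sum_congr rfl fun j hj => ?_
  rw [wordContent]
  congr 1
  ext p
  simp only [mem_filter, mem_univ, true_and, and_iff_right_iff_imp]
  rintro rfl
  simpa using hj

/-- Partial sums of a zero-padded list: for `a ≤ N`, `∑_{j < a} L_j = (L.take a).sum` (indices in
`Fin N`, entries beyond the length read as `0`). [folklore] -/
theorem sum_filter_lt_getD_eq_sum_take (L : List ℕ) {a : ℕ} (ha : a ≤ N) :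
    ∑ j ∈ univ.filter (fun j : Fin N => (j : ℕ) < a), L.getD j 0 = (L.take a).sum := by
  induction a with
  | zero => simp
  | succ a ih =>
    have ha' : a < N := ha
    have hsplit : (univ.filter fun j : Fin N => (j : ℕ) < a + 1) =
        insert ⟨a, ha'⟩ (univ.filter fun j : Fin N => (j : ℕ) < a) := by
      ext j
      simp only [mem_filter, mem_univ, true_and, mem_insert, Fin.ext_iff]
      omega
    rw [hsplit, Finset.sum_insert (by simp), ih ha'.le, add_comm]
    have hget : L.getD ((⟨a, ha'⟩ : Fin N) : ℕ) 0 = L.getD a 0 := rfl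
    rw [hget]
    by_cases hl : a < L.length
    · rw [List.sum_take_succ _ _ hl, List.getD_eq_getElem _ _ hl]
    · push Not at hl
      rw [List.getD_eq_default _ _ hl, List.take_of_length_le hl,
        List.take_of_length_le (by omega), add_zero]

/-- **The dominance violation**: if `π ∈ 𝔖_N`, `π ≠ 1`, and `c ∈ ℕ^N` satisfies
`ρ_{π j} + c_j = lam_j + ρ_j` for all `j` (i.e. `c = lam + ρ - ρ∘π`), then some partial sum of `c`
strictly exceeds that of `lam`: with `i₀` the least non-fixed point of `π`, `c_j = lam_j` for
`j < i₀` and `c_{i₀} > lam_{i₀}` since `π i₀ > i₀`. (Fulton–Harris, proof of Prop. 4.37: the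
`ψ`'s other than `ψ_λ` occurring in `ω_λ` are `ψ_μ` with `μ ▷ λ`.)
[cite: FultonHarrisGTM129, §4.3 (proof of Prop. 4.37)] -/
theorem exists_partialSum_lt_of_ne_one (lam c : Fin N → ℕ) {π : Equiv.Perm (Fin N)} (hπ : π ≠ 1)
    (hc : ∀ j, rho N (π j) + c j = lam j + rho N j) :
    ∃ a, a ≤ N ∧ ∑ j ∈ univ.filter (fun j : Fin N => (j : ℕ) < a), lam j <
      ∑ j ∈ univ.filter (fun j : Fin N => (j : ℕ) < a), c j := by
  -- the least non-fixed point
  have hne : (univ.filter fun i : Fin N => π i ≠ i).Nonempty := by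
    by_contra h
    rw [Finset.not_nonempty_iff_eq_empty, Finset.filter_eq_empty_iff] at h
    exact hπ (Equiv.ext fun i => by simpa using h (mem_univ i))
  set i₀ := (univ.filter fun i : Fin N => π i ≠ i).min' hne with hi₀
  have hi₀mem : π i₀ ≠ i₀ := by
    have := Finset.min'_mem _ hne
    rw [← hi₀] at this
    simpa using this
  have hfix : ∀ j : Fin N, j < i₀ → π j = j := by
    intro j hj
    by_contra h
    have : i₀ ≤ j := by
      rw [hi₀]
      exact Finset.min'_le _ _ (by simpa using h)
    exact absurd hj (not_lt.2 this)
  have hlt : i₀ < π i₀ := by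
    rcases lt_trichotomy i₀ (π i₀) with h | h | h
    · exact h
    · exact absurd h.symm hi₀mem
    · exact absurd (π.injective (hfix _ h)) hi₀mem
  refine ⟨i₀ + 1, by omega, ?_⟩
  have hsplit : (univ.filter fun j : Fin N => (j : ℕ) < (i₀ : ℕ) + 1) =
      insert i₀ (univ.filter fun j : Fin N => (j : ℕ) < i₀) := by
    ext j
    simp only [mem_filter, mem_univ, true_and, mem_insert, Fin.ext_iff]
    omega
  rw [hsplit, Finset.sum_insert (by simp), Finset.sum_insert (by simp)]
  have heq : ∑ j ∈ univ.filter (fun j : Fin N => (j : ℕ) < i₀), c j =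
      ∑ j ∈ univ.filter (fun j : Fin N => (j : ℕ) < i₀), lam j := by
    refine Finset.sum_congr rfl fun j hj => ?_
    have hj' : j < i₀ := by simpa using hj
    have := hc j
    rw [hfix j hj'] at this
    omega
  rw [heq]
  have h1 := hc i₀
  have h2 : rho N (π i₀) < rho N i₀ := by
    rw [rho_apply, rho_apply]
    have := (π i₀).2
    have hlt' : (i₀ : ℕ) < π i₀ := hlt
    omega
  omega

end Counting

section Vanishing

variable {N D : ℕ}

/-- `χ^λ(1) = f^λ ≠ 0`. [folklore] -/
theorem spechtCharacter_one_ne_zero' (lam : Nat.Partition D) : spechtCharacter ℂ lam 1 ≠ 0 := by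
  rw [show spechtCharacter ℂ lam 1 = (finrank ℂ (spechtIdeal ℂ lam) : ℂ) from
    Representation.char_one _, finrank_spechtIdeal_holds ℂ lam, Nat.cast_ne_zero]
  exact (numStandardTableaux_pos_holds lam).ne'

/-- **Dominance kills the character sum over the stabiliser**: if for some `a` the word `w` has
more than `λ₁ + ⋯ + λ_a` positions with letters `< a`, then `∑_{σ ∈ Stab w} χ^λ(σ) = 0`
(contrapositive of the tree's majorisation property
`card_filter_lt_le_of_wordIsotypicMatrix_diag_ne_zero`, through `(P_λ)_{ww} = (f^λ/D!)∑_{Stab w}χ^λ`).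
[cite: FultonHarrisGTM129, Lemma 4.23 (1) with §4.3] -/
theorem sum_stab_spechtCharacter_eq_zero_of_lt (lam : Nat.Partition D) (w : Word N D) {a : ℕ}
    (h : (lam.sortedParts.take a).sum < (univ.filter fun p : Fin D => (w p : ℕ) < a).card) :
    ∑ σ ∈ stabFinset w, spechtCharacter ℂ lam σ = 0 := by
  by_contra hne
  have hdiag : wordIsotypicMatrix N D lam w w ≠ 0 := by
    rw [wordIsotypicMatrix_diag_eq]
    refine mul_ne_zero (div_ne_zero (spechtCharacter_one_ne_zero' lam) ?_) hne
    exact Nat.cast_ne_zero.2 Fintype.card_ne_zero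
  have hle := card_filter_lt_le_of_wordIsotypicMatrix_diag_ne_zero hdiag a
  rw [card_filter_rowOf_lt] at hle
  omega

/-- The words counted by the `τ`-term of Frobenius's coefficient, `τ ≠ 1`, violate dominance:
`∑_{σ ∈ Stab w} χ^λ(σ) = 0` whenever `ρ_{τ⁻¹ j} + cont(w)_j = λ_j + ρ_j` for all `j`.
[cite: FultonHarrisGTM129, §4.3 (proof of Prop. 4.37)] -/
theorem sum_stab_spechtCharacter_eq_zero_of_ne_one (lam : Nat.Partition D) {τ : Equiv.Perm (Fin N)}
    (hτ : τ ≠ 1) (w : Word N D)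
    (hw : ∀ j, rho N (τ⁻¹ j) + wordExps N w j = lam.sortedParts.getD j 0 + rho N j) :
    ∑ σ ∈ stabFinset w, spechtCharacter ℂ lam σ = 0 := by
  have hτ' : τ⁻¹ ≠ 1 := fun h => hτ (inv_eq_one.1 h)
  obtain ⟨a, ha, hlt⟩ := exists_partialSum_lt_of_ne_one (fun j => lam.sortedParts.getD j 0)
    (fun j => wordExps N w j) hτ' hw
  refine sum_stab_spechtCharacter_eq_zero_of_lt lam w (a := a) ?_
  rw [← sum_filter_lt_getD_eq_sum_take _ ha, card_filter_lt_eq_sum_wordContent]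
  exact lt_of_lt_of_eq hlt (Finset.sum_congr rfl fun j _ => wordExps_apply_eq_wordContent w j)

end Vanishing


/-! ### The `τ = 1` term: the words of content `λ`, one orbit through the row word -/

section RowWord

variable {N D : ℕ}

/-- Left absorption: `p · a_μ = a_μ` for `p` in the row group. [folklore] -/
theorem of_mul_rowSymmetrizer {μ : Nat.Partition D} {p : Equiv.Perm (Fin D)}
    (hp : p ∈ rowStabilizer μ) :
    MonoidAlgebra.of ℂ _ p * rowSymmetrizer ℂ μ = rowSymmetrizer ℂ μ := by
  classical
  unfold rowSymmetrizer
  rw [Finset.mul_sum]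
  refine Finset.sum_equiv (Equiv.mulLeft p) (fun σ => ?_) (fun σ _ => ?_)
  · simp only [Equiv.coe_mulLeft, Set.mem_toFinset, SetLike.mem_coe]
    constructor
    · exact fun h => (rowStabilizer μ).mul_mem hp h
    · intro h
      have := (rowStabilizer μ).mul_mem ((rowStabilizer μ).inv_mem hp) h
      rwa [inv_mul_cancel_left] at this
  · rw [Equiv.coe_mulLeft, map_mul]

/-- The stabiliser of the row word `p ↦ rowOf p` is the row group `R_λ`. [folklore] -/
theorem mem_wordStabilizer_rowWord_iff (lam : Nat.Partition D) (w₀ : Word N D)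
    (hw₀ : ∀ p, (w₀ p : ℕ) = lam.rowOf p) (σ : Equiv.Perm (Fin D)) :
    σ ∈ wordStabilizer w₀ ↔ σ ∈ rowStabilizer lam := by
  rw [mem_wordStabilizer_iff, mem_rowStabilizer_iff]
  refine forall_congr' fun p => ?_
  rw [Fin.ext_iff, hw₀, hw₀]

/-- Hence `stabFinset` of the row word is the row group as a finset, and its symmetrizer is the
row symmetrizer `a_λ`. [folklore] -/
theorem stabSymmetrizer_rowWord (lam : Nat.Partition D) (w₀ : Word N D)
    (hw₀ : ∀ p, (w₀ p : ℕ) = lam.rowOf p) :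
    stabSymmetrizer w₀ = rowSymmetrizer ℂ lam := by
  classical
  unfold stabSymmetrizer rowSymmetrizer
  refine Finset.sum_congr ?_ fun _ _ => rfl
  ext σ
  rw [mem_stabFinset, Set.mem_toFinset, SetLike.mem_coe, mem_wordStabilizer_rowWord_iff lam w₀ hw₀]

/-- The content of the row word is `λ` (padded): `#{p | rowOf p = j} = λ_j`. [folklore] -/
theorem wordContent_rowWord (lam : Nat.Partition D) (w₀ : Word N D)
    (hw₀ : ∀ p, (w₀ p : ℕ) = lam.rowOf p) (j : Fin N) :
    wordContent w₀ j = lam.sortedParts.getD j 0 := by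
  have hsplit : (univ.filter fun p : Fin D => lam.rowOf p < (j : ℕ) + 1) =
      (univ.filter fun p : Fin D => lam.rowOf p < (j : ℕ)) ∪
        (univ.filter fun p : Fin D => w₀ p = j) := by
    ext p
    simp only [mem_filter, mem_univ, true_and, mem_union, Fin.ext_iff, hw₀]
    omega
  have hdisj : Disjoint (univ.filter fun p : Fin D => lam.rowOf p < (j : ℕ))
      (univ.filter fun p : Fin D => w₀ p = j) := by
    rw [Finset.disjoint_filter]
    intro p _ h1 h2
    rw [Fin.ext_iff, hw₀] at h2
    omega
  have hcard := congr_arg Finset.card hsplit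
  rw [Finset.card_union_of_disjoint hdisj, card_filter_rowOf_lt, card_filter_rowOf_lt] at hcard
  rw [wordContent]
  by_cases hl : (j : ℕ) < lam.sortedParts.length
  · rw [List.sum_take_succ _ _ hl, List.getD_eq_getElem _ _ hl] at *
    omega
  · push Not at hl
    rw [List.getD_eq_default _ _ hl]
    rw [List.take_of_length_le hl, List.take_of_length_le (by omega)] at hcard
    omega

/-- **`K_{λλ} = 1`**: the `R_λ`-invariants of the Specht module `S^λ = ℂ[𝔖_D] c_λ` form the line
`ℂ c_λ` (an invariant `v = z c_λ` has `|R_λ| v = a_λ v = a_λ z a_λ b_λ ∈ ℂ c_λ` by Fulton–Harris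
Lemma 4.23 (2), and `c_λ = a_λ b_λ` is `R_λ`-invariant), so the trivial character of the Young
subgroup `𝔖_λ` occurs exactly once in `S^λ` (Fulton–Harris (4.41)/Cor. 4.39: `K_{λλ} = 1`).
[cite: FultonHarrisGTM129, Lemma 4.23 (2) and Cor. 4.39] -/
theorem finrank_invariants_rowWord (lam : Nat.Partition D) (w₀ : Word N D)
    (hw₀ : ∀ p, (w₀ p : ℕ) = lam.rowOf p) :
    finrank ℂ (spechtRepStab lam w₀).invariants = 1 := by
  classical
  set cvec : spechtIdeal ℂ lam := ⟨youngSymmetrizer ℂ lam,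
    Literature.NumberTheory.DiophantineGeometry.youngSymmetrizer_mem_spechtIdeal ℂ lam⟩ with hcvec
  have hcne : cvec ≠ 0 := by
    intro h
    have := congr_arg Subtype.val h
    exact youngSymmetrizer_ne_zero_holds (k := ℂ) lam this
  have hcard_pos : (stabFinset w₀).card ≠ 0 := (card_stabFinset_pos w₀).ne'
  -- the invariants are the line through `c_λ`
  have heq : (spechtRepStab lam w₀).invariants = ℂ ∙ cvec := by
    apply le_antisymm
    · intro v hv
      rw [Representation.mem_invariants] at hv
      -- `σ v = v` for `σ ∈ Stab(w₀) = R_λ`, in the group algebra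
      have hfix : ∀ σ ∈ wordStabilizer w₀,
          MonoidAlgebra.of ℂ _ σ * (v : MonoidAlgebra ℂ (Equiv.Perm (Fin D))) = v := by
        intro σ hσ
        have h1 := congr_arg Subtype.val (hv ⟨σ, hσ⟩)
        rw [← spechtRep_apply ℂ lam σ v]
        exact h1
      have hav : rowSymmetrizer ℂ lam * (v : MonoidAlgebra ℂ (Equiv.Perm (Fin D))) =
          ((stabFinset w₀).card : ℂ) • (v : MonoidAlgebra ℂ (Equiv.Perm (Fin D))) := by
        rw [← stabSymmetrizer_rowWord lam w₀ hw₀]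
        exact stabSymmetrizer_mul_eq_card_smul w₀ hfix
      obtain ⟨z, hz⟩ := Ideal.mem_span_singleton'.1 v.2
      obtain ⟨t, ht⟩ := exists_rowSymmetrizer_mul_mul_colAntisymmetrizer (k := ℂ) lam
        (z * rowSymmetrizer ℂ lam)
      have hav' : rowSymmetrizer ℂ lam * (v : MonoidAlgebra ℂ (Equiv.Perm (Fin D))) =
          t • youngSymmetrizer ℂ lam := by
        rw [← hz, ← ht, youngSymmetrizer]
        simp only [mul_assoc]
      rw [Submodule.mem_span_singleton]
      refine ⟨((stabFinset w₀).card : ℂ)⁻¹ * t, Subtype.ext ?_⟩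
      rw [Submodule.coe_smul_of_tower, hcvec, Subtype.coe_mk, mul_smul, ← hav', hav,
        inv_smul_smul₀ (Nat.cast_ne_zero.2 hcard_pos)]
    · rw [Submodule.span_singleton_le_iff_mem, Representation.mem_invariants]
      rintro ⟨σ, hσ⟩
      apply Subtype.ext
      change (spechtRep ℂ lam σ cvec : MonoidAlgebra ℂ (Equiv.Perm (Fin D))) = cvec
      rw [spechtRep_apply, hcvec, Subtype.coe_mk, youngSymmetrizer, ← mul_assoc,
        of_mul_rowSymmetrizer ((mem_wordStabilizer_rowWord_iff lam w₀ hw₀ σ).1 hσ)]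
  rw [heq, finrank_span_singleton hcne]

/-- `∑_{σ ∈ Stab(w ∘ g)} χ^λ(σ) = ∑_{σ ∈ Stab w} χ^λ(σ)` (conjugate stabilisers, class function).
[folklore] -/
theorem sum_stabFinset_comp_perm (lam : Nat.Partition D) (w : Word N D) (g : Equiv.Perm (Fin D)) :
    ∑ σ ∈ stabFinset (w ∘ ⇑g), spechtCharacter ℂ lam σ =
      ∑ σ ∈ stabFinset w, spechtCharacter ℂ lam σ := by
  symm
  refine Finset.sum_equiv (MulAut.conj g⁻¹).toEquiv (fun σ => ?_) (fun σ _ => ?_)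
  · simp only [MulEquiv.toEquiv_eq_coe, MulEquiv.coe_toEquiv, MulAut.conj_apply, inv_inv,
      mem_stabFinset, mem_wordStabilizer_iff_comp]
    constructor
    · intro h
      funext p
      have := congr_fun h (g p)
      simpa using this
    · intro h
      funext p
      have := congr_fun h (g⁻¹ p)
      simpa using this
  · simp only [MulEquiv.toEquiv_eq_coe, MulEquiv.coe_toEquiv, MulAut.conj_apply, inv_inv]
    exact (spechtCharacter_conj ℂ lam σ g⁻¹).symm

/-- **The `τ = 1` term**: over the words of content `λ` (the orbit of the row word),
`∑_{cont w = λ} ∑_{σ ∈ Stab w} χ^λ(σ) = D!` (`= D! · ⟨ψ_λ, χ_λ⟩ = D! · K_{λλ}`).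
[cite: FultonHarrisGTM129, §4.3 Cor. 4.39] -/
theorem sum_sum_stab_spechtCharacter_rowWord (lam : Nat.Partition D) (w₀ : Word N D)
    (hw₀ : ∀ p, (w₀ p : ℕ) = lam.rowOf p) :
    ∑ w ∈ univ.filter (fun w : Word N D => ∀ j, wordContent w j = wordContent w₀ j),
      ∑ σ ∈ stabFinset w, spechtCharacter ℂ lam σ = (D.factorial : ℂ) := by
  have h := sum_comp_perm_eq_card_stab_smul (M := ℂ) w₀
    (fun w => ∑ σ ∈ stabFinset w, spechtCharacter ℂ lam σ)
  simp only [sum_stabFinset_comp_perm, Finset.sum_const, Finset.card_univ, Fintype.card_perm,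
    Fintype.card_fin, filter_comp_eq_stabFinset, nsmul_eq_mul] at h
  rw [sum_spechtCharacter_wordStabilizer, finrank_invariants_rowWord lam w₀ hw₀, Nat.cast_one,
    mul_one, mul_comm] at h
  have hS : ((stabFinset w₀).card : ℂ) ≠ 0 := Nat.cast_ne_zero.2 (card_stabFinset_pos w₀).ne'
  have h' := mul_left_cancel₀ hS h
  convert h'.symm using 2
  ext u
  simp only [mem_filter, mem_univ, true_and, wordContent]

end RowWord

/-! ### `⟨X^λ, χ^λ⟩ = 1` -/

section Inner

variable {N D : ℕ}

/-- **`∑_σ X^λ(σ) χ^λ(σ) = D!`** for `λ ⊢ D` with at most `N` parts and `X^λ = [x^{λ+ρ}] a_ρ F_σ`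
in `N` variables (Fulton–Harris, proof of Prop. 4.37: `ω_λ = χ_λ + ∑_{μ ▷ λ} c_μ χ_μ`, i.e.
`⟨ω_λ, χ_λ⟩ = 1`): expanding `X^λ = ∑_τ sign(τ) ψ_{λ+ρ-ρτ}` and `∑_σ ψ(σ)χ(σ) =
∑_w ∑_{Stab w} χ`, the words of the `τ ≠ 1` terms violate dominance
(`sum_stab_spechtCharacter_eq_zero_of_ne_one`) and the `τ = 1` term is the orbit of the row word
(`sum_sum_stab_spechtCharacter_rowWord`). [cite: FultonHarrisGTM129, §4.3 Prop. 4.37 (proof)] -/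
theorem sum_frobeniusChar_mul_spechtCharacter (lam : Nat.Partition D) (hN : lam.parts.card ≤ N) :
    ∑ σ : Equiv.Perm (Fin D),
      (frobeniusChar N (fun i => lam.sortedParts.getD i 0) σ : ℂ) * spechtCharacter ℂ lam σ =
      (D.factorial : ℂ) := by
  -- the row word
  have hrow : ∀ p : Fin D, lam.rowOf p < N := fun p =>
    lt_of_lt_of_le (lam.rowOf_lt_length p) (by rwa [Nat.Partition.length_sortedParts])
  set w₀ : Word N D := fun p => ⟨lam.rowOf p, hrow p⟩ with hw₀def
  have hw₀ : ∀ p, (w₀ p : ℕ) = lam.rowOf p := fun p => rfl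
  -- the word sets of the `τ`-terms
  set W : Equiv.Perm (Fin N) → Finset (Word N D) := fun τ => univ.filter fun w : Word N D =>
    ∀ j, rho N (τ⁻¹ j) + wordExps N w j = lam.sortedParts.getD j 0 + rho N j with hW
  -- expand `X^λ` and exchange the sums
  have h1 : ∀ σ : Equiv.Perm (Fin D),
      (frobeniusChar N (fun i => lam.sortedParts.getD i 0) σ : ℂ) * spechtCharacter ℂ lam σ =
      ∑ τ : Equiv.Perm (Fin N), ((Equiv.Perm.sign τ : ℤ) : ℂ) *
        ((((W τ).filter fun w => w ∘ ⇑σ = w).card : ℂ) * spechtCharacter ℂ lam σ) := by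
    intro σ
    rw [frobeniusChar_eq_sum_sign_mul_card, Int.cast_sum, Finset.sum_mul]
    refine Finset.sum_congr rfl fun τ _ => ?_
    rw [Int.cast_mul, Int.cast_natCast, mul_assoc]
    congr 3
    rw [hW, Finset.filter_filter]
    congr 1
    ext w
    simp only [mem_filter, mem_univ, true_and]
    exact and_comm
  simp_rw [h1]
  rw [Finset.sum_comm]
  simp_rw [← Finset.mul_sum, sum_card_filter_mul_eq_sum_sum_stab]
  -- only `τ = 1` survives
  rw [Finset.sum_eq_single (1 : Equiv.Perm (Fin N))]
  · rw [Equiv.Perm.sign_one, Units.val_one, Int.cast_one, one_mul]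
    have hW1 : W 1 = univ.filter (fun w : Word N D => ∀ j, wordContent w j = wordContent w₀ j) := by
      rw [hW]
      ext w
      simp only [mem_filter, mem_univ, true_and, inv_one, Equiv.Perm.one_apply]
      refine forall_congr' fun j => ?_
      rw [wordContent_rowWord lam w₀ hw₀ j, wordExps_apply_eq_wordContent]
      omega
    rw [hW1]
    exact sum_sum_stab_spechtCharacter_rowWord lam w₀ hw₀
  · intro τ _ hτ
    rw [Finset.sum_eq_zero, mul_zero]
    intro w hw
    rw [hW] at hw
    exact sum_stab_spechtCharacter_eq_zero_of_ne_one lam hτ w (by simpa using hw)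
  · intro h
    exact absurd (mem_univ _) h

end Inner

/-! ### Frobenius's character formula -/

section Frobenius

variable {N D : ℕ}

/-- `∑_σ χ^λ(σ)² = D!` (orthonormality of the irreducible Specht character, `χ^λ` being real:
`χ^λ(σ⁻¹) = χ^λ(σ)`). [folklore] -/
theorem sum_spechtCharacter_mul_self (lam : Nat.Partition D) :
    ∑ σ : Equiv.Perm (Fin D), spechtCharacter ℂ lam σ * spechtCharacter ℂ lam σ =
      (D.factorial : ℂ) := by
  classical
  haveI : (spechtRep ℂ lam).IsIrreducible := isIrreducible_spechtRep_holds (k := ℂ) lam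
  have hcard_pos : (Nat.card (Equiv.Perm (Fin D)) : ℂ) ≠ 0 := Nat.cast_ne_zero.2 Nat.card_pos.ne'
  letI : Invertible (Nat.card (Equiv.Perm (Fin D)) : ℂ) := invertibleOfNonzero hcard_pos
  have horth := Representation.char_orthonormal (spechtRep ℂ lam) (spechtRep ℂ lam)
  have hne : Nonempty ((spechtRep ℂ lam).Equiv (spechtRep ℂ lam)) := ⟨Representation.Equiv.refl _⟩
  rw [if_pos hne] at horth
  have hcardk : (Nat.card (Equiv.Perm (Fin D)) : ℂ) = (D.factorial : ℂ) := by
    rw [Nat.card_eq_fintype_card, Fintype.card_perm, Fintype.card_fin]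
  have h1 : ∑ σ : Equiv.Perm (Fin D), spechtCharacter ℂ lam σ * spechtCharacter ℂ lam σ =
      ∑ σ : Equiv.Perm (Fin D), (spechtRep ℂ lam).character σ * (spechtRep ℂ lam).character σ⁻¹ := by
    refine Finset.sum_congr rfl fun σ _ => ?_
    rw [← Literature.NumberTheory.DiophantineGeometry.spechtCharacter_eq_character,
      spechtCharacter_inv]
  rw [h1]
  have h2 := congr_arg (fun z => (Nat.card (Equiv.Perm (Fin D)) : ℂ) * z) horth
  simp only [← mul_assoc, mul_inv_cancel₀ hcard_pos, one_mul, mul_one] at h2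
  rw [h2, hcardk]

/-- The padded parts vector `(λ₁, …, λ_ℓ, 0, …, 0) ∈ ℕ^N` is weakly decreasing. [folklore] -/
theorem getD_sortedParts_antitone (lam : Nat.Partition D) :
    Antitone (fun i : Fin N => lam.sortedParts.getD i 0) := by
  intro i j hij
  dsimp only
  by_cases hj : (j : ℕ) < lam.sortedParts.length
  · rw [List.getD_eq_getElem _ _ hj, List.getD_eq_getElem _ _ (lt_of_le_of_lt hij hj)]
    exact List.sortedGE_iff_getElem_ge_getElem_of_le.mp lam.sortedGE_sortedParts hij
  · rw [List.getD_eq_default _ _ (not_lt.mp hj)]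
    exact Nat.zero_le _

/-- `λ + ρ` is injective (strictly decreasing). [folklore] -/
theorem injective_getD_sortedParts_add_rho (lam : Nat.Partition D) :
    Function.Injective ((fun i : Fin N => lam.sortedParts.getD i 0) + rho N) := by
  have hanti : StrictAnti ((fun i : Fin N => lam.sortedParts.getD i 0) + rho N) := by
    intro i j hij
    have h1 := getD_sortedParts_antitone (N := N) lam hij.le
    simp only [Pi.add_apply, rho_apply]
    have := j.2
    have hij' : (i : ℕ) < j := hij
    dsimp only at h1
    omega
  exact hanti.injective

/-- `∑_i λ_i = D` for the padded parts vector when `N ≥ ℓ(λ)`. [folklore] -/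
theorem sum_getD_sortedParts (lam : Nat.Partition D) (hN : lam.parts.card ≤ N) :
    ∑ i : Fin N, lam.sortedParts.getD i 0 = D := by
  have h := sum_filter_lt_getD_eq_sum_take (N := N) lam.sortedParts (a := N) le_rfl
  rw [Finset.filter_true_of_mem (fun j _ => j.2), List.take_of_length_le
    (by rwa [Nat.Partition.length_sortedParts]), Nat.Partition.sum_sortedParts] at h
  exact h

/-- **Frobenius's character formula** (Frobenius 1900; Fulton–Harris, *Representation Theory*,
Thm. 4.10 / formula (4.10); Macdonald, *Symmetric Functions*, I (7.8)): for a partition `λ ⊢ D`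
with at most `N` parts and every `σ ∈ 𝔖_D`,
`χ^λ(σ) = [x^{λ+ρ}] ( a_ρ(x) · ∏_{cycles c of σ} p_{|c|}(x) )`, `ρ = (N-1, …, 1, 0)`,
`a_ρ = ∏_{i<j}(x_i - x_j)`, i.e. the Specht character is Frobenius's alternating coefficient
`frobeniusChar N λ σ = ∑_{τ ∈ 𝔖_N} sign(τ) · #{words fixed by σ of content λ + ρ - ρ∘τ⁻¹}`.
Proof (Frobenius/Schur, as in Fulton–Harris §4.3 but without Young's rule or the completeness of
the Specht modules): with `X = X^λ`, `χ = χ^λ` real-valued class functions,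
`∑ X² = D!` (`sum_frobeniusChar_mul_self`: Burnside + Cauchy), `∑ X χ = D!`
(`sum_frobeniusChar_mul_spechtCharacter`: dominance + `K_{λλ} = 1`) and `∑ χ² = D!`
(orthonormality), so `∑ (X - χ)² = 0` and `X = χ`.
[cite: FultonHarrisGTM129, Theorem 4.10] -/
theorem spechtCharacter_eq_frobeniusChar (lam : Nat.Partition D) (hN : lam.parts.card ≤ N)
    (σ : Equiv.Perm (Fin D)) :
    spechtCharacter ℂ lam σ = (frobeniusChar N (fun i => lam.sortedParts.getD i 0) σ : ℂ) := by
  set X : Equiv.Perm (Fin D) → ℂ := fun σ =>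
    (frobeniusChar N (fun i => lam.sortedParts.getD i 0) σ : ℂ) with hX
  set χ : Equiv.Perm (Fin D) → ℂ := fun σ => spechtCharacter ℂ lam σ with hχ
  -- the three second moments
  have hXX : ∑ σ, X σ * X σ = (D.factorial : ℂ) := by
    have h := sum_frobeniusChar_mul_self (ι := Fin D) (fun i : Fin N => lam.sortedParts.getD i 0)
      (injective_getD_sortedParts_add_rho lam) (by rw [sum_getD_sortedParts lam hN, Fintype.card_fin])
    have h' := congr_arg (fun z : ℤ => (z : ℂ)) h
    simpa [hX] using h'
  have hXχ : ∑ σ, X σ * χ σ = (D.factorial : ℂ) := sum_frobeniusChar_mul_spechtCharacter lam hN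
  have hχχ : ∑ σ, χ σ * χ σ = (D.factorial : ℂ) := sum_spechtCharacter_mul_self lam
  -- `∑ (X - χ)² = 0`
  have hsq : ∑ σ, (X σ - χ σ) * (X σ - χ σ) = 0 := by
    have : ∀ σ, (X σ - χ σ) * (X σ - χ σ) = X σ * X σ - 2 * (X σ * χ σ) + χ σ * χ σ := by
      intro σ; ring
    simp_rw [this]
    rw [Finset.sum_add_distrib, Finset.sum_sub_distrib, ← Finset.mul_sum, hXX, hXχ, hχχ]
    ring
  -- the differences are real
  have hreal : ∀ σ, X σ - χ σ = (((X σ - χ σ).re : ℝ) : ℂ) := by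
    intro σ
    symm
    rw [← Complex.conj_eq_iff_re, map_sub]
    congr 1
    · simp [hX]
    · exact star_spechtCharacter lam σ
  have hsq' : ∑ σ, ((X σ - χ σ).re) ^ 2 = 0 := by
    have h : ((∑ σ, ((X σ - χ σ).re) ^ 2 : ℝ) : ℂ) = ∑ σ, (X σ - χ σ) * (X σ - χ σ) := by
      push_cast
      refine Finset.sum_congr rfl fun σ _ => ?_
      rw [sq, ← hreal σ]
    rw [hsq] at h
    exact_mod_cast h
  have hzero : ((X σ - χ σ).re) ^ 2 = 0 :=
    (Finset.sum_eq_zero_iff_of_nonneg (fun σ _ => sq_nonneg _)).1 hsq' σ (mem_univ σ)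
  have : X σ - χ σ = 0 := by
    rw [hreal σ, pow_eq_zero_iff (two_ne_zero)  |>.1 hzero, Complex.ofReal_zero]
  exact (sub_eq_zero.1 this).symm

/-- Frobenius's formula in the alternating-sum form (Fulton–Harris (4.41), Macdonald I (7.6)´):
`χ^λ(σ) = ∑_{τ ∈ 𝔖_N} sign(τ) · #{w : [D] → [N] | w ∘ σ = w, cont(w) = λ + ρ - ρ∘τ⁻¹}`
(the determinantal expansion `χ^λ = ∑_τ sign(τ) Ind_{𝔖_{λ+ρ-τρ}} 1` evaluated at `σ`).
[cite: FultonHarrisGTM129, §4.3 (4.41)] -/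
theorem spechtCharacter_eq_sum_sign_mul_card (lam : Nat.Partition D) (hN : lam.parts.card ≤ N)
    (σ : Equiv.Perm (Fin D)) :
    spechtCharacter ℂ lam σ = ∑ τ : Equiv.Perm (Fin N), ((Equiv.Perm.sign τ : ℤ) : ℂ) *
      ((univ.filter fun w : Word N D => w ∘ ⇑σ = w ∧
        ∀ j, rho N (τ⁻¹ j) + wordContent w j = lam.sortedParts.getD j 0 + rho N j).card : ℂ) := by
  rw [spechtCharacter_eq_frobeniusChar lam hN σ, frobeniusChar_eq_sum_sign_mul_card, Int.cast_sum]
  refine Finset.sum_congr rfl fun τ _ => ?_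
  rw [Int.cast_mul, Int.cast_natCast]
  rfl

end Frobenius

end Literature.RepresentationTheory.FiniteGroups

end
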